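import Summits.KontsevichZagierPeriods.KontsevichZagierPeriods.Theses.FurushoPentagon
import Literature.NumberTheory.Transcendental.MZVWordShuffle

/-!
# drefute — `stub_shuffleWords` of line `dilation-homotopy-transposition` (crux stmt-KontsevichZagierPeriods-3930)

Pure list combinatorics: the words obtained by inserting the letter `1` at the gaps `1, …, n` of
`0^{s₁-1}1⋯0^{s_k-1}1` are Hoffman's split indices together with the insertions `(…, s_i, 1, …)`.
Proved for every index with positive entries (by induction on the index, `Z` generalised), which
contains the admissible case of the stub.
-/

set_option linter.dupNamespace false
open Literature.NumberTheory.Transcendental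

namespace Summit.KontsevichZagierPeriods.KontsevichZagierPeriods.Cruxes.HoffmanRelationInKZ.DrefuteWords

variable {M : Type*} [AddCommGroup M]

/-! ### List helpers -/

theorem list_sum_range (n : ℕ) (F : ℕ → M) :
    ((List.range n).map F).sum = ∑ i ∈ Finset.range n, F i := by
  induction n with
  | zero => simp
  | succ n ih => rw [List.range_succ, List.map_append, List.sum_append, ih, Finset.sum_range_succ]; simp

/-- Inserting inside a run of `false`s. -/
theorem insertIdx_replicate_false (p r : ℕ) (w : List Bool) :
    (List.replicate (p + r) false ++ w).insertIdx p true =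
      List.replicate p false ++ true :: (List.replicate r false ++ w) := by
  induction p with
  | zero => simp
  | succ p ih =>
    rw [show p + 1 + r = (p + r) + 1 by omega, List.replicate_succ, List.cons_append,
      List.insertIdx_succ_cons, ih, List.replicate_succ, List.cons_append]

/-- Inserting beyond a prefix. -/
theorem insertIdx_append_right (l₁ l₂ : List Bool) (k : ℕ) (x : Bool) :
    (l₁ ++ l₂).insertIdx (l₁.length + k) x = l₁ ++ l₂.insertIdx k x := by
  induction l₁ with
  | nil => simp
  | cons b l₁ ih =>
    rw [List.length_cons, show l₁.length + 1 + k = (l₁.length + k) + 1 by omega, List.cons_append,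
      List.insertIdx_succ_cons, ih, List.cons_append]

/-- Reading a block `0^m 1` in front of a word. -/
theorem ofBinaryWordAux_block (c m : ℕ) (w : List Bool) :
    MZV.ofBinaryWordAux c (List.replicate m false ++ true :: w) = (c + m + 1) :: MZV.ofBinaryWord w := by
  induction m generalizing c with
  | zero => simp [MZV.ofBinaryWord]
  | succ m ih =>
    rw [List.replicate_succ, List.cons_append, MZV.ofBinaryWordAux_false, ih]
    congr 1; omega

theorem ofBinaryWord_block (m : ℕ) (w : List Bool) :
    MZV.ofBinaryWord (List.replicate m false ++ true :: w) = (m + 1) :: MZV.ofBinaryWord w := by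
  rw [MZV.ofBinaryWord, ofBinaryWordAux_block]; simp

theorem binaryWord_cons (a : ℕ) (t : List ℕ) :
    MZV.binaryWord (a :: t) = List.replicate (a - 1) false ++ true :: MZV.binaryWord t := by
  simp [MZV.binaryWord]

/-- The first block `0^{a-1} 1` as a prefix: insertion at position `a - 1 + 1 + k`. -/
theorem insertIdx_after_block (a : ℕ) (w : List Bool) (k : ℕ) :
    (List.replicate (a - 1) false ++ true :: w).insertIdx (a - 1 + 1 + k) true =
      List.replicate (a - 1) false ++ true :: w.insertIdx k true := by
  have h := insertIdx_append_right (List.replicate (a - 1) false ++ [true]) w k true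
  simp only [List.length_append, List.length_replicate, List.length_singleton, List.append_assoc,
    List.singleton_append] at h
  exact h

/-! ### The three sums -/

/-- Gap sum. -/
def gapSum (Z : List ℕ → M) (s : List ℕ) : M :=
  ((List.range (MZV.weight s)).map fun g => Z (MZV.ofBinaryWord ((MZV.binaryWord s).insertIdx (g + 1) true))).sum

/-- Split sum. -/
def splitSum (Z : List ℕ → M) (s : List ℕ) : M :=
  ((List.range s.length).map fun i =>
    ((List.range (s.getD i 0 - 1)).map fun j => Z (s.take i ++ [s.getD i 0 - j, j + 1] ++ s.drop (i + 1))).sum).sum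

/-- Insertion sum. -/
def insSum (Z : List ℕ → M) (s : List ℕ) : M :=
  ((List.range s.length).map fun i => Z (s.take (i + 1) ++ [1] ++ s.drop (i + 1))).sum

/-! ### Recursions in the index -/

theorem splitSum_cons (Z : List ℕ → M) (a : ℕ) (t : List ℕ) :
    splitSum Z (a :: t) =
      ((List.range (a - 1)).map fun j => Z ((a - j) :: (j + 1) :: t)).sum + splitSum (fun u => Z (a :: u)) t := by
  rw [splitSum, splitSum, List.length_cons, List.range_succ_eq_map, List.map_cons, List.sum_cons, List.map_map]
  congr 1

theorem insSum_cons (Z : List ℕ → M) (a : ℕ) (t : List ℕ) :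
    insSum Z (a :: t) = Z (a :: 1 :: t) + insSum (fun u => Z (a :: u)) t := by
  rw [insSum, insSum, List.length_cons, List.range_succ_eq_map, List.map_cons, List.sum_cons, List.map_map]
  congr 1

theorem gapSum_cons (Z : List ℕ → M) {a : ℕ} (ha : 1 ≤ a) (t : List ℕ) (ht : ∀ x ∈ t, 1 ≤ x) :
    gapSum Z (a :: t) =
      ((List.range (a - 1)).map fun g => Z ((g + 2) :: (a - 1 - g) :: t)).sum + Z (a :: 1 :: t) +
        gapSum (fun u => Z (a :: u)) t := by
  have hw : MZV.weight (a :: t) = (a - 1) + 1 + MZV.weight t := by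
    simp [MZV.weight]; omega
  have hobw : MZV.ofBinaryWord (MZV.binaryWord t) = t := MZV.ofBinaryWord_binaryWord ht
  rw [gapSum, gapSum, hw, List.range_add, List.range_succ, List.map_append, List.map_append, List.sum_append,
    List.sum_append, List.map_map, List.map_singleton, List.sum_singleton, binaryWord_cons]
  congr 1
  · congr 1
    · -- insertions inside the first block
      refine congrArg List.sum (List.map_congr_left fun g hg => ?_)
      rw [List.mem_range] at hg
      have key : (List.replicate (a - 1) false ++ true :: MZV.binaryWord t).insertIdx (g + 1) true =
          List.replicate (g + 1) false ++ true :: (List.replicate (a - 2 - g) false ++ true :: MZV.binaryWord t) := by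
        rw [show a - 1 = (g + 1) + (a - 2 - g) by omega]
        exact insertIdx_replicate_false _ _ _
      have e1 : g + 1 + 1 = g + 2 := by omega
      have e2 : a - 2 - g + 1 = a - 1 - g := by omega
      rw [key, ofBinaryWord_block, ofBinaryWord_block, hobw, e1, e2]
    · -- insertion right after the first block
      have h := insertIdx_after_block a (MZV.binaryWord t) 0
      rw [Nat.add_zero] at h
      rw [h, List.insertIdx_zero, ofBinaryWord_block, Nat.sub_add_cancel ha, MZV.ofBinaryWord,
        MZV.ofBinaryWordAux_true, Nat.zero_add]
      change Z (a :: 1 :: MZV.ofBinaryWord (MZV.binaryWord t)) = _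
      rw [hobw]
  · -- insertions in the tail
    refine congrArg List.sum (List.map_congr_left fun g _ => ?_)
    simp only [Function.comp]
    rw [show a - 1 + 1 + g + 1 = a - 1 + 1 + (g + 1) by ring, insertIdx_after_block, ofBinaryWord_block,
      Nat.sub_add_cancel ha]

/-- Reflection of the inner-block insertions onto the splits of the first block. -/
theorem inner_eq_splits (Z : List ℕ → M) (a : ℕ) (t : List ℕ) :
    ((List.range (a - 1)).map fun g => Z ((g + 2) :: (a - 1 - g) :: t)).sum =
      ((List.range (a - 1)).map fun j => Z ((a - j) :: (j + 1) :: t)).sum := by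
  rw [list_sum_range, list_sum_range,
    ← Finset.sum_range_reflect (fun j => Z ((a - j) :: (j + 1) :: t)) (a - 1)]
  refine Finset.sum_congr rfl fun g hg => ?_
  rw [Finset.mem_range] at hg
  show Z ((g + 2) :: (a - 1 - g) :: t) = Z ((a - (a - 1 - 1 - g)) :: (a - 1 - 1 - g + 1) :: t)
  have e1 : a - (a - 1 - 1 - g) = g + 2 := by omega
  have e2 : a - 1 - 1 - g + 1 = a - 1 - g := by omega
  rw [e1, e2]

/-- **The identity for every index with positive entries.** -/
theorem gapSum_eq (s : List ℕ) (hs : ∀ x ∈ s, 1 ≤ x) (Z : List ℕ → M) :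
    gapSum Z s = splitSum Z s + insSum Z s := by
  induction s generalizing Z with
  | nil => simp [gapSum, splitSum, insSum, MZV.weight]
  | cons a t ih =>
    have ha : 1 ≤ a := hs a (by simp)
    have ht : ∀ x ∈ t, 1 ≤ x := fun x hx => hs x (by simp [hx])
    rw [gapSum_cons Z ha t ht, splitSum_cons, insSum_cons, ih ht, inner_eq_splits]
    abel

/-- **`stub_shuffleWords` of the lead's skeleton, PROVED** (type copied verbatim). -/
theorem stub_shuffleWords_proof : ∀ (s : List ℕ), MZV.IsAdmissible s → ∀ Z : List ℕ → KZ.FormalRep, ((List.range (MZV.weight s)).map (fun g => Z (MZV.ofBinaryWord ((MZV.binaryWord s).insertIdx (g + 1) true)))).sum = ((List.range s.length).map (fun i => ((List.range (s.getD i 0 - 1)).map (fun j => Z (s.take i ++ [s.getD i 0 - j, j + 1] ++ s.drop (i + 1)))).sum)).sum + ((List.range s.length).map (fun i => Z (s.take (i + 1) ++ [1] ++ s.drop (i + 1)))).sum := by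
  intro s hs Z
  exact gapSum_eq s hs.1 Z

end Summit.KontsevichZagierPeriods.KontsevichZagierPeriods.Cruxes.HoffmanRelationInKZ.DrefuteWords
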